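import Summits.BirchSwinnertonDyer.BirchSwinnertonDyer.Theorems.ByReductionTypeAtTwoAdditiveKatoFineConjADischarge
import Summits.BirchSwinnertonDyer.BirchSwinnertonDyer.Theorems.ResidualThetaTransportAtTwoSignedMuSeedAtTwoPlusDivisionTowerTwoFour
import Literature.NumberTheory.EllipticCurves.AnomalousOfRationalTorsionProofs
import HarnessLib

/-!
# Route `ByReductionTypeAtTwo` (rung K4), crux `AdditiveRankZeroAtTwo` (item stmt-BirchSwinnertonDyer-19098),
# line add_twist_overK v2, stub `stub_addDefectUpper` (hU3): Coates–Sujatha's statement (A) at `(E, 2)` is a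
# THEOREM FROM PRINT whenever `E[2]` is REDUCIBLE — the displayed hypothesis of the additive Kato-fine doors is
# discharged BY NAME on the `E[2]`-reducible sub-block, for every curve at once (a `--supports` file; seat
# `bsd-2adic-addL2x` GEN 9; sequel of `…AdditiveKatoFineConjADischarge.lean`; outside the route file's import cone)

HONEST FRAMING (cell `bsd-2adic`, HUMAN RULING D-0036/D-0054): types-the-object-of; closes none at the ∀-level;
nothing booked; BSD is not proved by any of this. CONDITIONAL ONLY on two PRINT facts taken by name (`hLim2`, `hFW`);
no class data inside; no reading of my own is used here.

WHAT THIS FILE DOES. After GEN 8 the registered stub `stub_addDefectUpper` (the ∀ upper half on the defect-≥3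
block) reads: on the `E[2]`-IRREDUCIBLE sub-block it follows from statement (A) at `(E, 2)` alone
(`addDefectUpper_irreducible_of_conjA`, sharp reading), and §1 of `…KatoFineConjADischarge.lean` discharges (A)`(W,2)`
from Lim 2017 Thm. 3.5 at `p = 2` (`hLim2`) plus EITHER a Fukuda class-group certificate OR an ABELIAN subfield
`L ≤ ℚ(E[4])` of `2`-power index (Ferrero–Washington, `hFW`) — with `L`, `L ≤ ℚ(E[4])` and the index DISPLAYED as
hypotheses. This file SUPPLIES that abelian subfield, in the kernel, for EVERY elliptic `W/ℚ` whose `E[2]` is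
REDUCIBLE (a rational point of order `2`), from two tree theorems: the Borel field of a stable line
(`WeierstrassCurve.exists_abelian_le_divisionField_of_not_irreducible`, seat bsd-potss-rkm: `M ≤ ℚ(E[2])` abelian
with `[ℚ(E[2]) : ℚ] = 2^k·[M : ℚ]`; at `p = 2` both characters `χ₁, χ₂ : Γ_ℚ → 𝔽₂^× = 1` are trivial, so `M = ℚ`)
and the `2 → 4` division tower (`SignedMuAtTwo.ResolventEllipticUnits.divisionTowerTwoFour`, seat bsd-wall-rtt-p4-w3:
`ℚ(E[2]) ≤ ℚ(E[4])` with `[ℚ(E[4]) : ℚ] = 2^j·[ℚ(E[2]) : ℚ]`). Hence: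

* §1 `conjA_two_of_not_irreducible` — **for every elliptic `W/ℚ` with `E[2]` reducible, statement (A) at `(W, 2)`**
  (`∃ γ D` spelling of the doors), granted `hLim2` + `hFW` BY NAME; `conjA_two_of_dvd_torsionOrder` — the same keyed
  on `2 ∣ #E(ℚ)_tors` (the decide-level class fact; Mazur: rational `2`-torsion ⇒ `E[2]` reducible).
  SCOPE (Lim@2 rider of 2026-08-28, recorded on the fact's docstring): the witness field here is the Borel field
  `M = ℚ` — `r₁(M) = 1`, `M ∩ ℚ^{cyc} = ℚ` — one of the two shapes the rider certifies as inside the printed proof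
  (the layers `ℚ(ζ_{2^{n+2}})⁺` have units of every signature). The CYCLIC-CUBIC case (`E[2]` irreducible,
  `Gal(ℚ(E[2])/ℚ) ≅ C₃`, abelian but totally real with `r₁ = 3`) is reachable by the same three names with
  `L = ℚ(E[2])` but lies OUTSIDE that scope (narrow `μ₂` = wide `μ₂` not supplied by print); it is deliberately NOT
  typed here — its honest witness `ℚ(E[2], i) ≤ ℚ(E[4])` needs `μ₄ ⊂ ℚ(E[4])` (Weil pairing), not in the tree for
  `WeierstrassCurve.divisionField`.
* §2 `conjA_two_of_conjA_irreducible` — for ANY family of curves, statement (A) at `2` on the family follows from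
  statement (A) at `2` on its `E[2]`-IRREDUCIBLE members; `addBlock_conjA_two_of_irreducible` — the defect-≥3 block form:
  the conjectural input «(A) at `2` on the block» of the hU3 doors IS «(A) at `2` on the `E[2]`-irreducible sub-block»
  (1 172 of 1 382 census classes; the 210 reducible classes carry (A) by theorem). This is the exact scope of the
  statement item the planner proposes to file (RC-210 (3), `FineSelmerConjAAtTwoAdditiveIrred`).
* NOT here: an upper-half door on the reducible sub-block — no Kato reading at `p = 2` exists there (R-B45: every
  integrality/freeness step of the sharp reading uses `H⁰(·, E[2]) = 0`); what §1 changes is only that such a reading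
  would be UNCONDITIONAL (its (A)-input is now a theorem). The stub's exact residual stays GEN 8's
  `addDefectUpper_of_conjA_of_reducibleUpper` ((A) on the irreducible sub-block + the upper half on the reducible one).

Binders BY NAME: `hLim2` = `Lim2017.thm35_at_two_fineSelmerDual_moduleFinite_of_classicalMuVanishes_of_le_divisionField_four`
(PRINT, D-audit hLim35@2 PASS), `hFW` = `ferreroWashington1979_classicalMuVanishes` (PRINT, D-audit hFW PASS).
References: [Lim2017FineSelmer] §3 Thm. 3.5, Lemma 3.2, Remark (a); [CoatesSujatha2005] statement (A), Thm. 3.4,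
Cor. 3.6; [Wuthrich2014] Lemma 14 (p. 396: «If E admits an isogeny of degree p defined over ℚ, then the fine Selmer
group R(E/ℚ_∞) is a finitely generated ℤ_p-module» — the p odd print of which §1 is the p = 2 twin through Lim@2);
[FerreroWashington1979]; [Serre1972] §IV; [Mazur1977] Ch. III §5. Memo: `run/shared/lean/pub/bsd-2adic/addL2x/VERDICT-19098-addL2x-GEN9.md`.
-/

set_option autoImplicit false
-- sibling precedent (`ByReductionTypeAtTwoAdditiveKatoFineConjADischarge.lean`): the directory name repeats the summit name
set_option linter.dupNamespace false

noncomputable section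

open scoped Classical

namespace Summit.BirchSwinnertonDyer.BirchSwinnertonDyer.Theorems.AddKatoTwo

open WeierstrassCurve Literature.NumberTheory.EllipticCurves
  Literature.NumberTheory.EllipticCurves.Rank1Residual
  Literature.NumberTheory.EllipticCurves.Rank1Residual.Typed
  Literature.NumberTheory.IwasawaTheory
  Summit.BirchSwinnertonDyer.Rank1Residual.X5.AddTwoL2

/-! ## §1 Statement (A) at `(E, 2)` for REDUCIBLE `E[2]`, from print BY NAME -/

/-- **Statement (A) at `(W, 2)` for every elliptic `W/ℚ` with REDUCIBLE `E[2]`** (Coates–Sujatha's finite generation of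
the dual fine Selmer group over `ℚ^{cyc}`, `∃ γ D` spelling), granted Lim 2017 Thm. 3.5 at `p = 2` (`hLim2`) and
Ferrero–Washington (`hFW`) BY NAME. Kernel: the Borel field `M ≤ ℚ(E[2])` of a stable line is abelian over `ℚ` with
`[ℚ(E[2]) : ℚ] = 2^k·[M : ℚ]` (`exists_abelian_le_divisionField_of_not_irreducible`; at `p = 2`, `M = ℚ`), and
`ℚ(E[2]) ≤ ℚ(E[4])` with `2`-power index (`divisionTowerTwoFour`), so `M ≤ ℚ(E[4])` is an abelian subfield of
`2`-power index and `conjA_two_of_abelianSubfield` applies. The `p = 2` twin, through Lim@2, of Wuthrich's Lemma 14 /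
Coates–Sujatha Cor. 3.6 (printed for odd `p`). [cite: Lim2017FineSelmer, §3 Thm. 3.5, Lemma 3.2 and Remark (a)]
[cite: CoatesSujatha2005, statement (A), Thm. 3.4 and Cor. 3.6] [cite: Wuthrich2014, Lemma 14 (p. 396)]
[cite: FerreroWashington1979, Theorem] -/
theorem conjA_two_of_not_irreducible
    (hLim2 : Lim2017.thm35_at_two_fineSelmerDual_moduleFinite_of_classicalMuVanishes_of_le_divisionField_four)
    (hFW : ferreroWashington1979_classicalMuVanishes)
    (W : WeierstrassCurve ℚ) [W.IsElliptic] (hred : ¬ W.HasIrreducibleModPGaloisRep 2) :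
    ∀ (κ : ZpExtension ℚ 2), κ.IsCyclotomic →
      ∃ (γ : Field.absoluteGaloisGroup ℚ) (D : W.FineSelmerDualData κ γ),
        Module.Finite ℤ_[2] (RestrictScalars ℤ_[2] (IwasawaAlgebra 2) D.X) := by
  haveI : Fact (Nat.Prime 2) := ⟨Nat.prime_two⟩
  obtain ⟨M, hM2, _hfin, hab, k, -, hk⟩ :=
    exists_abelian_le_divisionField_of_not_irreducible (W := W) (p := 2) hred
  obtain ⟨h24, j, hj⟩ := SignedMuAtTwo.ResolventEllipticUnits.divisionTowerTwoFour W
  haveI : IsAbelianGalois ℚ M := hab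
  have hdeg : ∃ n : ℕ, Module.finrank ℚ (W.divisionField 4) = 2 ^ n * Module.finrank ℚ M :=
    ⟨j + k, by rw [hj, hk, ← mul_assoc, ← pow_add]⟩
  exact conjA_two_of_abelianSubfield hLim2 hFW W M (hM2.trans h24) hdeg

/-- **Statement (A) at `(W, 2)` for every elliptic, globally minimal `W/ℚ` with `2 ∣ #E(ℚ)_tors`** (a rational point of
order `2` makes `E[2]` reducible: `not_hasIrreducibleModPGaloisRep_of_dvd_torsionOrder`), granted `hLim2` + `hFW` BY NAME —
the class-fact keying of `conjA_two_of_not_irreducible`. [cite: Lim2017FineSelmer, §3 Thm. 3.5, Lemma 3.2 and Remark (a)]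
[cite: Mazur1977, Ch. III §5, p. 157] [cite: FerreroWashington1979, Theorem] -/
theorem conjA_two_of_dvd_torsionOrder
    (hLim2 : Lim2017.thm35_at_two_fineSelmerDual_moduleFinite_of_classicalMuVanishes_of_le_divisionField_four)
    (hFW : ferreroWashington1979_classicalMuVanishes)
    (W : WeierstrassCurve ℚ) [W.IsElliptic] [W.IsGloballyMinimal] (htors : 2 ∣ W.torsionOrder) :
    ∀ (κ : ZpExtension ℚ 2), κ.IsCyclotomic →
      ∃ (γ : Field.absoluteGaloisGroup ℚ) (D : W.FineSelmerDualData κ γ),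
        Module.Finite ℤ_[2] (RestrictScalars ℤ_[2] (IwasawaAlgebra 2) D.X) :=
  haveI : Fact (Nat.Prime 2) := ⟨Nat.prime_two⟩
  conjA_two_of_not_irreducible hLim2 hFW W (not_hasIrreducibleModPGaloisRep_of_dvd_torsionOrder W 2 htors)

/-! ## §2 Statement (A) at `2` on a family = statement (A) at `2` on its `E[2]`-irreducible members -/

/-- **(A) at `2` for all elliptic curves over `ℚ` from (A) at `2` for those with IRREDUCIBLE `E[2]`**, granted `hLim2` +
`hFW` BY NAME (the reducible ones carry (A) by `conjA_two_of_not_irreducible`). Family-free form; nothing asserted about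
the irreducible case (a named published conjecture: Coates–Sujatha 2005 Conjecture A at `p = 2`).
[cite: CoatesSujatha2005, statement (A) and Cor. 3.6] [cite: Lim2017FineSelmer, §3 Thm. 3.5] -/
theorem conjA_two_of_conjA_irreducible
    (hLim2 : Lim2017.thm35_at_two_fineSelmerDual_moduleFinite_of_classicalMuVanishes_of_le_divisionField_four)
    (hFW : ferreroWashington1979_classicalMuVanishes)
    (hAirr : ∀ (W : WeierstrassCurve ℚ) [W.IsElliptic], W.HasIrreducibleModPGaloisRep 2 →
      ∀ (κ : ZpExtension ℚ 2), κ.IsCyclotomic →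
        ∃ (γ : Field.absoluteGaloisGroup ℚ) (D : W.FineSelmerDualData κ γ),
          Module.Finite ℤ_[2] (RestrictScalars ℤ_[2] (IwasawaAlgebra 2) D.X))
    (W : WeierstrassCurve ℚ) [W.IsElliptic] :
    ∀ (κ : ZpExtension ℚ 2), κ.IsCyclotomic →
      ∃ (γ : Field.absoluteGaloisGroup ℚ) (D : W.FineSelmerDualData κ γ),
        Module.Finite ℤ_[2] (RestrictScalars ℤ_[2] (IwasawaAlgebra 2) D.X) := by
  by_cases hirr : W.HasIrreducibleModPGaloisRep 2
  · exact hAirr W hirr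
  · exact conjA_two_of_not_irreducible hLim2 hFW W hirr

/-- **The defect-≥3 block form: the conjectural input «(A) at `2` on the block» of the hU3 doors IS «(A) at `2` on the
`E[2]`-IRREDUCIBLE sub-block».** For non-CM, globally minimal, `r_an = 0` curves with `DefectAtLeastThree`: (A) at `2`
on those with irreducible `E[2]` (hypothesis `hAirr`, the shape of the planner's proposed statement item
`FineSelmerConjAAtTwoAdditiveIrred`, RC-210 (3)) gives (A) at `2` on ALL of them, granted `hLim2` + `hFW` BY NAME.
Conditional; nothing asserted. [cite: CoatesSujatha2005, statement (A) and Cor. 3.6] [cite: Lim2017FineSelmer, §3 Thm. 3.5] -/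
theorem addBlock_conjA_two_of_irreducible
    (hLim2 : Lim2017.thm35_at_two_fineSelmerDual_moduleFinite_of_classicalMuVanishes_of_le_divisionField_four)
    (hFW : ferreroWashington1979_classicalMuVanishes)
    (hAirr : ∀ (W : WeierstrassCurve ℚ) [W.IsElliptic] [W.IsGloballyMinimal], ¬ W.HasCM → W.analyticRank = 0 →
      DefectAtLeastThree W → W.HasIrreducibleModPGaloisRep 2 →
      ∀ (κ : ZpExtension ℚ 2), κ.IsCyclotomic →
        ∃ (γ : Field.absoluteGaloisGroup ℚ) (D : W.FineSelmerDualData κ γ),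
          Module.Finite ℤ_[2] (RestrictScalars ℤ_[2] (IwasawaAlgebra 2) D.X)) :
    ∀ (W : WeierstrassCurve ℚ) [W.IsElliptic] [W.IsGloballyMinimal], ¬ W.HasCM → W.analyticRank = 0 →
      DefectAtLeastThree W →
      ∀ (κ : ZpExtension ℚ 2), κ.IsCyclotomic →
        ∃ (γ : Field.absoluteGaloisGroup ℚ) (D : W.FineSelmerDualData κ γ),
          Module.Finite ℤ_[2] (RestrictScalars ℤ_[2] (IwasawaAlgebra 2) D.X) := by
  intro W _ _ hcm hr hdef
  by_cases hirr : W.HasIrreducibleModPGaloisRep 2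
  · exact hAirr W hcm hr hdef hirr
  · exact conjA_two_of_not_irreducible hLim2 hFW W hirr

end Summit.BirchSwinnertonDyer.BirchSwinnertonDyer.Theorems.AddKatoTwo

end
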